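import Summits.BirchSwinnertonDyer.Rank1Residual.ManinAdditive.MinusOneLevelRaisingProof
import Summits.BirchSwinnertonDyer.BirchSwinnertonDyer.Theorems.ManinLocalTwoThreeAdditiveDyadicTransport
import Summits.BirchSwinnertonDyer.Rank1Residual.ManinAdditive.MinusOneTwistLatticeRotationProof
import Literature.NumberTheory.EllipticCurves.NewformsMainLemmaTraceProofs
import Literature.NumberTheory.EllipticCurves.NewformPeterssonSizeRankinSelbergProofs
import Literature.NumberTheory.EllipticCurves.RankinSeriesTwistEulerFactorProofs
import Literature.NumberTheory.EllipticCurves.ModularDegreeQuadraticTwistProofs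
import Literature.NumberTheory.EllipticCurves.ModularCurveNeronLatticeProofs
import Literature.NumberTheory.EllipticCurves.EichlerShimuraConstructionProofs
import HarnessLib

/-!
# E-an-145D `MinusOneLevelRaisingDegree` is a THEOREM (`deg′ = 4·deg` on the level-raising `χ₋₄`-orbit) and the
# `4 ∥ N` stratum of C2 reduces to `8 ∣ N` modulo optimal-partner existence (cell `bsd-f2-manin`, -an g32, MEMO-an §75.7)

§5 Zagier's formula `deg · covol(Λ_W) = 4π² c² Re(f,f)_{Γ₀(N)}` for both data of a level-raising pair;
`covol(Λ_{W′}) = covol(Λ_W)` (`W′ = u • (W ⊗ (−1))` by E-an-145R, `u² = 1` by Connell–Pal `Δ(W′) = Δ(W)`);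
`c′² = c²` (E-an-145R); and the CROSS-LEVEL Petersson comparison `ψ(N) Re(f′,f′)_{N′} = ψ(N′) Re(f,f)_N`
(`gamma0Index_mul_re_peterssonProduct_eq_of_norm_cuspCoeff_eq`: equal `|aₙ|` + Rankin's residue
`Res_{w=2} Σ|aₙ|² n^{-w} = 48π Re(f,f)/ψ(N)` at each level), with `ψ(4N) = 4ψ(N)` for even `N`; hence
`minusOneLevelRaisingDegree_holds`.
§6 S-an-57 `MinusOneLevelRaisingOptimalPartner` (support / existence Prop, in print: Eichler–Shimura optimal
quotient of the twisted newform; nothing asserted) and `two_not_dvd_c_of_four_dvd_of_eight_dvd_stratum`: given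
S-an-57, `2 ∤ c` on every lattice-optimal datum with `8 ∣ N` implies it on every lattice-optimal datum with `4 ∣ N`.
Nothing here is BSD; C2 (`ManinOddAtFour`) stays OPEN.
[cite: ZagierCMB1985, §1 (p. 374)] [cite: Rankin1939, Thm. 3] [cite: Watkins2002, §2.1 (p. 491)]

TYPER NOTE (typer g17, TURNKEY-an-22 B2).  Landed VERBATIM from HOME/an/g32/MinusOneLevelRaisingDegreeProof.lean sha16
cf720938a7e5a168 (211 l.) = PART B2 (sections `Degree`, `Stratum`) of the -an seat's kernel-certified scratch
MinusOneLevelRaisingAll.lean (6e04a7a1edf1d79f: farm rc 0 · 0 err · 0 warn · 0 sorry, axioms standard — an g32 and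
independently ref1 §R122), except: this note, and three `import` lines carried over from an's B1 (the landed B1
`MinusOneLevelRaisingProof.lean` was reduced to by-name one-liners over p2's p693677 and no longer imports them).
ONE new `def … : Prop`, statement-only, used only as an explicit hypothesis: **S-an-57 `MinusOneLevelRaisingOptimalPartner`**
(support / existence; ref1 §R122: BC7 CLEAN, «TRUE in print — a construction/port item, not a conjecture»; census
168 649 / 168 649 optimal classes with `v₂(N) = 2`, `N ≤ 5·10⁵`).  bears_on: stmt-BirchSwinnertonDyer-22967 (C2).
BSD is not proved by this; Manin's conjecture is not proved by this; C2/C3 OPEN.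
-/

noncomputable section

open scoped MatrixGroups ModularForm

open CongruenceSubgroup WeierstrassCurve
  Literature.NumberTheory.DiophantineGeometry
  Literature.NumberTheory.EllipticCurves
  Literature.NumberTheory.EllipticCurves.ModularForms
  Summit.BirchSwinnertonDyer.BirchSwinnertonDyer.Theorems

namespace Summit.BirchSwinnertonDyer.Rank1Residual.ManinAdditive

section Degree

/-! ## §5 E-an-145D is a THEOREM: `deg′ = 4·deg` on the level-raising `χ₋₄`-orbit

Zagier's formula `deg · covol(Λ_W) = 4π² c² Re(f,f)_{Γ₀(N)}` for both data; `covol(Λ_{W′}) = covol(Λ_W)`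
(`W′ = u • (W ⊗ (−1))`, `u² = 1` by Connell–Pal `Δ(W′) = Δ(W)`); `c′² = c²` (E-an-145R); and the CROSS-LEVEL
Petersson comparison `ψ(N) · Re(f′,f′)_{Γ₀(N′)} = ψ(N′) · Re(f,f)_{Γ₀(N)}` from equal `|aₙ|` and Rankin's residue
`Res_{w=2} Σ|aₙ|² n^{-w} = 48π Re(f,f)/ψ(N)` at each level, with `ψ(4N) = 4ψ(N)` for even `N`. -/

/-- `ψ(4N) = 4ψ(N)` for even `N ≠ 0` (`ψ = [SL₂(ℤ) : Γ₀(·)]`). -/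
theorem gamma0Index_four_mul_of_two_dvd {N : ℕ} (hN : N ≠ 0) (h2 : 2 ∣ N) :
    gamma0Index (4 * N) = 4 * gamma0Index N := by
  have h2N : gamma0Index (2 * N) = 2 * gamma0Index N := gamma0Index_mul_of_prime_dvd Nat.prime_two hN h2
  have h4N : gamma0Index (2 * (2 * N)) = 2 * gamma0Index (2 * N) :=
    gamma0Index_mul_of_prime_dvd Nat.prime_two (by positivity) (dvd_mul_right 2 N)
  rw [show 4 * N = 2 * (2 * N) by ring, h4N, h2N]
  ring

/-- **Cross-level Petersson comparison (Rankin's residue at each level):** cusp forms `f ∈ S₂(Γ₀(N))`,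
`g ∈ S₂(Γ₀(N′))` with `|aₙ(g)| = |aₙ(f)|` for all `n` satisfy `ψ(N) · Re(g,g)_{N′} = ψ(N′) · Re(f,f)_N`. -/
theorem gamma0Index_mul_re_peterssonProduct_eq_of_norm_cuspCoeff_eq {N N' : ℕ} [NeZero N] [NeZero N']
    (f : CuspForm (Gamma0 N) 2) (g : CuspForm (Gamma0 N') 2)
    (h : ∀ n : ℕ, ‖cuspCoeff g n‖ = ‖cuspCoeff f n‖) :
    (gamma0Index N : ℝ) * (peterssonProduct (Gamma0 N') 2 g g).re =
      (gamma0Index N' : ℝ) * (peterssonProduct (Gamma0 N) 2 f f).re := by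
  have hf := tendsto_sub_two_mul_tsum_normSq_cuspCoeff_div_rpow f
  have hg := tendsto_sub_two_mul_tsum_normSq_cuspCoeff_div_rpow g
  have hfun : (fun w : ℝ ↦ (w - 2) * ∑' n : ℕ, ‖cuspCoeff g n‖ ^ 2 / (n : ℝ) ^ w) =
      (fun w : ℝ ↦ (w - 2) * ∑' n : ℕ, ‖cuspCoeff f n‖ ^ 2 / (n : ℝ) ^ w) := by
    funext w
    simp_rw [h]
  rw [hfun] at hg
  have hlim := tendsto_nhds_unique hg hf
  have hψ : (gamma0Index N : ℝ) ≠ 0 := by exact_mod_cast (gamma0Index_pos N).ne'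
  have hψ' : (gamma0Index N' : ℝ) ≠ 0 := by exact_mod_cast (gamma0Index_pos N').ne'
  have hπ : (48 * Real.pi : ℝ) ≠ 0 := by positivity
  rw [div_eq_div_iff hψ' hψ] at hlim
  have h' : (48 * Real.pi) * ((gamma0Index N : ℝ) * (peterssonProduct (Gamma0 N') 2 g g).re) =
      (48 * Real.pi) * ((gamma0Index N' : ℝ) * (peterssonProduct (Gamma0 N) 2 f f).re) := by
    linear_combination hlim
  exact mul_left_cancel₀ hπ h'

/-- **E-an-145D is a THEOREM**: on the level-raising `χ₋₄`-orbit (`4 ∣ N(W)`, `N(W′) = 4N(W)`, both data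
lattice-optimal) the modular degree is multiplied by exactly `4 = [Γ₀(N) : Γ₀(4N)]`. -/
theorem minusOneLevelRaisingDegree_holds : MinusOneLevelRaisingDegree := by
  intro W W' _ _ _ _ _ _ D D' hD hD' h4 hN hiso
  obtain ⟨⟨u, hu⟩, hc⟩ := minusOneLevelRaisingOptimalOrbit_holds W W' D D' hD hD' h4 hN hiso
  haveI : Fact (Nat.Prime 2) := ⟨Nat.prime_two⟩
  have h4' : 2 ^ 2 ∣ W'.conductorNorm ℤ := by
    rw [hN]; exact dvd_mul_of_dvd_right h4 4
  have hd0 : ((-1 : ℤ) : ℚ) ≠ 0 := by norm_num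
  -- (1) `|aₙ(W′)| = |aₙ(W)|`, hence `‖aₙ(f′)‖ = ‖aₙ(f)‖`
  obtain ⟨hngW, hnmW⟩ := not_good_and_not_mult_of_sq_dvd_conductorNorm W h4
  obtain ⟨hngW', hnmW'⟩ := not_good_and_not_mult_of_sq_dvd_conductorNorm W' h4'
  have hW0 : ∀ n : ℕ, 2 ∣ n → W.LFunction n = 0 := fun n hn ↦
    W.LFunction_apply_eq_zero_of_not_good_of_not_mult 2 hngW hnmW hn
  have hW'0 : ∀ n : ℕ, 2 ∣ n → W'.LFunction n = 0 := fun n hn ↦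
    W'.LFunction_apply_eq_zero_of_not_good_of_not_mult 2 hngW' hnmW' hn
  have habs : ∀ n : ℕ, (W'.LFunction n).natAbs = (W.LFunction n).natAbs :=
    natAbs_LFunction_eq_of_twist_even hd0 u hu (fun n ↦ ZMod.χ₄ n) natAbs_χ₄_of_odd
      (LFunction_quadraticTwist_negOne_intCast_of_odd W) hW0 hW'0
  have hcoef : ∀ n : ℕ, ‖cuspCoeff D'.f n‖ = ‖cuspCoeff D.f n‖ := by
    intro n
    rw [D'.isNewformOf.2 n, D.isNewformOf.2 n, Complex.norm_intCast, Complex.norm_intCast]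
    have key := congrArg (fun m : ℕ ↦ (m : ℝ)) (habs n)
    simp only [Nat.cast_natAbs, Int.cast_abs] at key
    exact key
  -- (2) Petersson norms across the two levels: `Re(f′,f′)_{N′} = 4 Re(f,f)_N`
  have hψ := gamma0Index_mul_re_peterssonProduct_eq_of_norm_cuspCoeff_eq D.f D'.f hcoef
  have hN0 : W.conductorNorm ℤ ≠ 0 := NeZero.ne _
  have h2N : 2 ∣ W.conductorNorm ℤ := dvd_trans ⟨2, by norm_num⟩ h4
  have hψ4 : (gamma0Index (W'.conductorNorm ℤ) : ℝ) = 4 * gamma0Index (W.conductorNorm ℤ) := by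
    rw [hN, gamma0Index_four_mul_of_two_dvd hN0 h2N]
    push_cast
    ring
  have hψ0 : (gamma0Index (W.conductorNorm ℤ) : ℝ) ≠ 0 := by
    exact_mod_cast (gamma0Index_pos (W.conductorNorm ℤ)).ne'
  have hP : (peterssonProduct (Gamma0 (W'.conductorNorm ℤ)) 2 D'.f D'.f).re =
      4 * (peterssonProduct (Gamma0 (W.conductorNorm ℤ)) 2 D.f D.f).re := by
    rw [hψ4] at hψ
    have h0 : (gamma0Index (W.conductorNorm ℤ) : ℝ) *
        ((peterssonProduct (Gamma0 (W'.conductorNorm ℤ)) 2 D'.f D'.f).re -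
          4 * (peterssonProduct (Gamma0 (W.conductorNorm ℤ)) 2 D.f D.f).re) = 0 := by
      linear_combination hψ
    rcases mul_eq_zero.mp h0 with h | h
    · exact absurd h hψ0
    · linarith
  -- (3) covolumes: `covol(Λ_{W′}) = covol(Λ_W)`
  have hΔ : W'.Δ = W.Δ := negOneTwistMinimalDiscrEq_holds W W' u h4 h4' hu
  have hΔ' : W'.Δ = ((-1 : ℤ) : ℚ) ^ 6 * W.Δ := by rw [hΔ]; norm_num
  have hu2 : ((u.u : ℚ)) ^ 2 = 1 := u_sq_eq_one_of_smul_quadraticTwist_of_Δ hd0 u hu hΔ'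
  set T := W.quadraticTwist ((-1 : ℤ) : ℚ) with hT
  haveI : T.IsElliptic := W.isElliptic_quadraticTwist hd0
  have hd0C : ((((-1 : ℤ) : ℚ)) : ℂ) ≠ 0 := by exact_mod_cast hd0
  have h4c : (T.baseChange ℂ).c₄ = ((((-1 : ℤ) : ℚ)) : ℂ) ^ 2 * (W.baseChange ℂ).c₄ := by
    simp only [hT, WeierstrassCurve.baseChange, WeierstrassCurve.map_c₄,
      WeierstrassCurve.quadraticTwist_c₄, map_mul, map_pow, eq_ratCast]
  have h6c : (T.baseChange ℂ).c₆ = ((((-1 : ℤ) : ℚ)) : ℂ) ^ 3 * (W.baseChange ℂ).c₆ := by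
    simp only [hT, WeierstrassCurve.baseChange, WeierstrassCurve.map_c₆,
      WeierstrassCurve.quadraticTwist_c₆, map_mul, map_pow, eq_ratCast]
  obtain ⟨LT, hLT⟩ : ∃ LT : PeriodPair, IsNeronLatticeOf (T.baseChange ℂ) LT :=
    exists_isNeronLatticeOf_holds (T.baseChange ℂ)
  have hcovT : ZLattice.covolume LT.lattice = ZLattice.covolume D.L.lattice := by
    rw [IsNeronLatticeOf.covolume_eq_div_of_c₄_eq_of_c₆_eq hd0C h4c h6c D.isNeronLattice hLT]
    norm_num
  have hD'L : IsNeronLatticeOf ((u • T).baseChange ℂ) D'.L := by rw [hu]; exact D'.isNeronLattice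
  have hcov' : ZLattice.covolume D'.L.lattice = ZLattice.covolume D.L.lattice := by
    rw [IsNeronLatticeOf.lattice_eq_mulLeft_of_smul u hLT hD'L, PeriodPair.covolume_mulLeft_lattice,
      hcovT]
    have hn : ‖((u.u : ℚ) : ℂ)‖ ^ 2 = 1 := by
      rw [show (((u.u : ℚ) : ℂ)) = ((((u.u : ℚ) : ℝ)) : ℂ) by norm_cast, Complex.norm_real,
        Real.norm_eq_abs, sq_abs]
      exact_mod_cast hu2
    rw [hn, one_mul]
  -- (4) Zagier's formula for both data
  have hZ := D.deg_mul_covolume_eq_re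
  have hZ' := D'.deg_mul_covolume_eq_re
  have hc2 : (D'.c : ℝ) ^ 2 = (D.c : ℝ) ^ 2 := by
    rcases hc with h | h
    · rw [h]
    · rw [h]; push_cast; ring
  rw [hcov', hP, hc2] at hZ'
  have hcov0 : ZLattice.covolume D.L.lattice ≠ 0 := (ZLattice.covolume_pos _ _).ne'
  have key : (D'.deg : ℝ) * ZLattice.covolume D.L.lattice =
      ((4 * D.deg : ℕ) : ℝ) * ZLattice.covolume D.L.lattice := by
    rw [hZ']
    push_cast
    linear_combination (-4 : ℝ) * hZ
  have hdeg : (D'.deg : ℝ) = ((4 * D.deg : ℕ) : ℝ) := mul_right_cancel₀ hcov0 key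
  simp only [ModularParametrizationData.modularDegree]
  exact_mod_cast hdeg

end Degree

section Stratum

/-! ## §6 The `4 ∥ N` stratum of C2 is ELIMINATED modulo optimal-partner existence (S-an-57) -/

/-- **S-an-57 `MinusOneLevelRaisingOptimalPartner` (support / existence, in print: Eichler–Shimura optimal
quotient of the twisted newform + Edixhoven integrality + Carayol; nothing asserted):** every lattice-optimal datum
of a curve `W` with `4 ∥ N(W)` has a level-raising `χ₋₄`-partner — a globally minimal `W′`, isogenous to
`W ⊗ χ₋₄`, with `N(W′) = 4·N(W)` and lattice-optimal data at level `N(W′)`.  Census: the twisted class exists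
and has `N′ = 4N` for 168 649/168 649 optimal classes with `v₂(N) = 2`, `N ≤ 5·10⁵`. -/
def MinusOneLevelRaisingOptimalPartner : Prop :=
  ∀ (W : WeierstrassCurve ℚ) [W.IsElliptic] [W.IsGloballyMinimal] [NeZero (W.conductorNorm ℤ)]
    (D : ModularParametrizationData W (W.conductorNorm ℤ)), IsLatticeOptimal D →
    2 ^ 2 ∣ W.conductorNorm ℤ → ¬ 2 ^ 3 ∣ W.conductorNorm ℤ →
    ∃ (W' : WeierstrassCurve ℚ) (_ : W'.IsElliptic) (_ : W'.IsGloballyMinimal)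
      (_ : NeZero (W'.conductorNorm ℤ)) (D' : ModularParametrizationData W' (W'.conductorNorm ℤ)),
      IsLatticeOptimal D' ∧ W'.conductorNorm ℤ = 4 * W.conductorNorm ℤ ∧
        IsIsogenous (W.quadraticTwist ((-1 : ℤ) : ℚ)) W'

/-- **PROVED: the `4 ∥ N` stratum of C2 reduces to the `8 ∣ N` stratum** (indeed to its `16 ∥ N` image),
given optimal-partner existence S-an-57: `2 ∤ c` for every lattice-optimal datum with `8 ∣ N` implies `2 ∤ c`
for every lattice-optimal datum with `4 ∣ N`. -/
theorem two_not_dvd_c_of_four_dvd_of_eight_dvd_stratum (hP : MinusOneLevelRaisingOptimalPartner)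
    (h8 : ∀ (W' : WeierstrassCurve ℚ) [W'.IsElliptic] [W'.IsGloballyMinimal] [NeZero (W'.conductorNorm ℤ)]
      (D' : ModularParametrizationData W' (W'.conductorNorm ℤ)),
      IsLatticeOptimal D' → 2 ^ 3 ∣ W'.conductorNorm ℤ → ¬ (2 : ℤ) ∣ D'.c)
    (W : WeierstrassCurve ℚ) [W.IsElliptic] [W.IsGloballyMinimal] [NeZero (W.conductorNorm ℤ)]
    (D : ModularParametrizationData W (W.conductorNorm ℤ)) (hD : IsLatticeOptimal D)
    (h4 : 2 ^ 2 ∣ W.conductorNorm ℤ) : ¬ (2 : ℤ) ∣ D.c := by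
  by_cases h8W : 2 ^ 3 ∣ W.conductorNorm ℤ
  · exact h8 W D hD h8W
  obtain ⟨W', _, _, _, D', hD', hN, hiso⟩ := hP W D hD h4 h8W
  have h8' : 2 ^ 3 ∣ W'.conductorNorm ℤ := by
    rw [hN]
    obtain ⟨k, hk⟩ := h4
    exact ⟨2 * k, by rw [hk]; ring⟩
  exact (levelRaising_two_not_dvd_c_iff D D' hD hD' h4 hN hiso).mpr (h8 W' D' hD' h8')

end Stratum

end Summit.BirchSwinnertonDyer.Rank1Residual.ManinAdditive
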